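import Mathlib
import Literature.Analysis.FluidPDE.Tao2016AveragedNS.ShiftSetCascadeFlows
import Literature.Analysis.FluidPDE.Tao2016AveragedNS.ShiftSetCascadeFlux
import Summits.NavierStokesRegularity.NavierStokesRegularity.Theorems.TaoLadderRungTwoFlatQuadPolarOn
import Summits.NavierStokesRegularity.NavierStokesRegularity.Theorems.TaoLadderRungTwoFlatLinearisedUniqueness
import Summits.NavierStokesRegularity.NavierStokesRegularity.Theorems.TaoLadderRungTwoFlatFlowContinuity
import HarnessLib

/-!
# The homogeneous `𝕊`-lattice as an ODE on `ℓ²(ℤ; ℝ^m)`: field, Lipschitz bound on balls, ENERGY NEUTRALITY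
  (helper for item stmt-NavierStokesRegularity-22987 `FlatGapCertificatesV2`, crux K_A♭ of route
  TaoLadderRungTwoFlat; cell harvest/h2-tao-ladder, p1 g20 — existence half behind `MirrorPulse.IsDatumSol`,
  referee carry A-79)

At scale ratio `1` Tao's nonlinearity `quadTermOn 𝕊 0 α` on a NEAREST-NEIGHBOUR shift set (the output at shell
`n` reads only the window `{n−1, n, n+1}`: `bilinOn_congr_window`) is a locally Lipschitz vector field on the
Hilbert space `ℓ²(ℤ; ℝ^m) = lp (fun _ : ℤ => EuclideanSpace ℝ (Fin m)) 2` of finite-energy states: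
* `l2Fam`, `l2FieldFun`, `l2Field` — the field `U ↦ (Q(U)_{i,n})`, `ℓ² → ℓ²`; pointwise bound
  `|Q(U)_{i,n} − Q(V)_{i,n}| ≤ 2‖α‖₁ρ (‖(U−V)_{n−1}‖ + ‖(U−V)_n‖ + ‖(U−V)_{n+1}‖)` on `‖U‖, ‖V‖ ≤ ρ`
  (`abs_quadTermOn_l2Fam_sub_le`, midpoint polarisation of `…FlowContinuity`), hence
  `‖Q(U) − Q(V)‖ ≤ 6√m ‖α‖₁ ρ ‖U − V‖` (`norm_l2Field_sub_le`, `lipschitzOnWith_l2Field`); `l2Field_neg`;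
* `inner_l2Field_self` — **energy neutrality** `⟪Q(U), U⟫ = 0` for slot-closed `𝕊` and a table cancelling on
  `𝕊` (Tao's (4.3)): the shell-wise bookkeeping `∑ᵢ Q(U)_{i,n}U_{i,n} = A_𝕊(n) − A_𝕊(n−1)` of
  `Literature…ShiftSetCascadeFlux` telescoped over `ℤ` (`A_𝕊` is summable for a finite-energy state).
The companion `…TaoLadderRungTwoFlatDatumExistence` integrates this field globally (energy = a priori bound).

HONEST FRAMING: ODE preliminaries for a MODEL lattice (Tao 2016 §4 vocabulary, shift-set parametrised); nothing
certified; nothing here is a statement about the Navier–Stokes equations.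
-/

noncomputable section

-- the sub-problem namespace repeats the summit name by design (D-0017)
set_option linter.dupNamespace false

namespace Summit.NavierStokesRegularity.NavierStokesRegularity.Theorems

open Set Filter Metric Literature.Analysis.FluidPDE Literature.Analysis.FluidPDE.TaoCascade
open scoped Topology NNReal ENNReal RealInnerProductSpace

namespace QuadPolar

variable {m : ℕ}

/-! ### Locality of the nonlinearity on a nearest-neighbour shift set -/

/-- The restriction of a family to the three-shell window `{n−1, n, n+1}` (zero elsewhere). [folklore] -/
def windowFam (n : ℤ) (X : Fin m → ℤ → ℝ → ℝ) : Fin m → ℤ → ℝ → ℝ :=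
  fun j k t => if n - 1 ≤ k ∧ k ≤ n + 1 then X j k t else 0

/-- Inside the window the restricted family is the family. [folklore] -/
theorem windowFam_of_mem {n k : ℤ} (hk : n - 1 ≤ k ∧ k ≤ n + 1) (X : Fin m → ℤ → ℝ → ℝ) (j : Fin m)
    (t : ℝ) : windowFam n X j k t = X j k t := by
  simp only [windowFam, if_pos hk]

/-- **Locality**: on a nearest-neighbour shift set the polarisation at shell `n` only reads its two slots
on the window `{n−1, n, n+1}`. [cite: Tao2016AveragedNS, §4 (4.8) and after (4.1) (the shift set); cell vocabulary, shift-set parametrised] -/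
theorem bilinOn_congr_window {𝕊 : Finset (ℤ × ℤ × ℤ)} (h𝕊 : IsNearestNeighbourSet 𝕊) (ε₀ : ℝ)
    (α : Fin m → Fin m → Fin m → ℤ × ℤ × ℤ → ℝ) {X X' Y Y' : Fin m → ℤ → ℝ → ℝ} {n : ℤ} {t : ℝ}
    (hX : ∀ j k, n - 1 ≤ k ∧ k ≤ n + 1 → X j k t = X' j k t)
    (hY : ∀ j k, n - 1 ≤ k ∧ k ≤ n + 1 → Y j k t = Y' j k t) (i : Fin m) :
    bilinOn 𝕊 ε₀ α X Y i n t = bilinOn 𝕊 ε₀ α X' Y' i n t := by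
  unfold bilinOn
  refine Finset.sum_congr rfl fun i₁ _ => Finset.sum_congr rfl fun i₂ _ =>
    Finset.sum_congr rfl fun μ hμ => ?_
  obtain ⟨h1, h2, h3⟩ := h𝕊 μ hμ
  have hk1 : n - 1 ≤ n - μ.2.2 + μ.1 ∧ n - μ.2.2 + μ.1 ≤ n + 1 := by omega
  have hk2 : n - 1 ≤ n - μ.2.2 + μ.2.1 ∧ n - μ.2.2 + μ.2.1 ≤ n + 1 := by omega
  rw [hX _ _ hk1, hY _ _ hk2]

/-- The linearisation at shell `n` only reads the perturbation on the window `{n−1, n, n+1}`.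
[cite: Tao2016AveragedNS, §4 (4.8); cell vocabulary, shift-set parametrised] -/
theorem linTermOn_windowFam {𝕊 : Finset (ℤ × ℤ × ℤ)} (h𝕊 : IsNearestNeighbourSet 𝕊) (ε₀ : ℝ)
    (α : Fin m → Fin m → Fin m → ℤ × ℤ × ℤ → ℝ) (W η : Fin m → ℤ → ℝ → ℝ) (i : Fin m) (n : ℤ) (t : ℝ) :
    linTermOn 𝕊 ε₀ α W (windowFam n η) i n t = linTermOn 𝕊 ε₀ α W η i n t := by
  unfold linTermOn
  rw [bilinOn_congr_window h𝕊 ε₀ α (X := W) (X' := W) (Y := windowFam n η) (Y' := η)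
      (fun _ _ _ => rfl) (fun j k hk => windowFam_of_mem hk η j t) i,
    bilinOn_congr_window h𝕊 ε₀ α (X := windowFam n η) (X' := η) (Y := W) (Y' := W)
      (fun j k hk => windowFam_of_mem hk η j t) (fun _ _ _ => rfl) i]

/-! ### Finite-energy states read as families -/

/-- A finite-energy state `U ∈ ℓ²(ℤ; ℝ^m)` read as a (time-constant) family `(j, k) ↦ U_k^j`. [folklore] -/
def l2Fam (U : lp (fun _ : ℤ => EuclideanSpace ℝ (Fin m)) 2) : Fin m → ℤ → ℝ → ℝ := fun j k _ => U k j

/-- A component of a vector of `ℝ^m` is bounded by its Euclidean norm. [folklore] -/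
theorem abs_apply_le_norm (x : EuclideanSpace ℝ (Fin m)) (j : Fin m) : |x j| ≤ ‖x‖ := by
  refine abs_le_of_sq_le_sq ?_ (norm_nonneg _)
  rw [PiLp.norm_sq_eq_of_L2]
  have h := Finset.single_le_sum (f := fun i => ‖x i‖ ^ 2) (fun i _ => sq_nonneg _) (Finset.mem_univ j)
  simpa [Real.norm_eq_abs, sq_abs] using h

/-- The Euclidean norm of a vector with components bounded by `B` is at most `√m · B` (squared form).
[folklore] -/
theorem norm_sq_le_of_abs_le (x : EuclideanSpace ℝ (Fin m)) {B : ℝ} (h : ∀ j, |x j| ≤ B) :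
    ‖x‖ ^ 2 ≤ m * B ^ 2 := by
  rw [PiLp.norm_sq_eq_of_L2]
  calc ∑ i, ‖x i‖ ^ 2 ≤ ∑ _i : Fin m, B ^ 2 := Finset.sum_le_sum fun i _ => by
          rw [Real.norm_eq_abs]
          exact pow_le_pow_left₀ (abs_nonneg _) (h i) 2
    _ = m * B ^ 2 := by simp

/-- Coordinates of a state are bounded by the shell norm. [folklore] -/
theorem abs_l2Fam_le_norm_apply (U : lp (fun _ : ℤ => EuclideanSpace ℝ (Fin m)) 2) (j : Fin m) (k : ℤ)
    (t : ℝ) : |l2Fam U j k t| ≤ ‖U k‖ :=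
  abs_apply_le_norm (U k) j

/-- Coordinates of a state are bounded by the norm. [folklore] -/
theorem abs_l2Fam_le (U : lp (fun _ : ℤ => EuclideanSpace ℝ (Fin m)) 2) (j : Fin m) (k : ℤ) (t : ℝ) :
    |l2Fam U j k t| ≤ ‖U‖ :=
  (abs_l2Fam_le_norm_apply U j k t).trans (lp.norm_apply_le_norm (by norm_num) U k)

/-- The squared norm of a finite-energy state is the sum of the squared shell norms. [folklore] -/
theorem hasSum_norm_sq (U : lp (fun _ : ℤ => EuclideanSpace ℝ (Fin m)) 2) :
    HasSum (fun k => ‖U k‖ ^ 2) (‖U‖ ^ 2) := by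
  have h := lp.hasSum_norm (by norm_num : 0 < (2 : ℝ≥0∞).toReal) U
  simpa [ENNReal.toReal_ofNat, Real.rpow_two] using h

/-- Shifted partial sums of the squared shell norms are bounded by the energy. [folklore] -/
theorem sum_norm_sq_shift_le (U : lp (fun _ : ℤ => EuclideanSpace ℝ (Fin m)) 2) (s : Finset ℤ) (c : ℤ) :
    ∑ k ∈ s, ‖U (k + c)‖ ^ 2 ≤ ‖U‖ ^ 2 := by
  have h : ∑ k ∈ s, ‖U (k + c)‖ ^ 2 = ∑ k ∈ s.map (Equiv.addRight c).toEmbedding, ‖U k‖ ^ 2 := by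
    rw [Finset.sum_map]
    rfl
  rw [h]
  exact sum_le_hasSum _ (fun k _ => sq_nonneg _) (hasSum_norm_sq U)

/-- Shifted squared shell norms are summable. [folklore] -/
theorem summable_norm_sq_shift (U : lp (fun _ : ℤ => EuclideanSpace ℝ (Fin m)) 2) (c : ℤ) :
    Summable fun k => ‖U (k + c)‖ ^ 2 :=
  (Equiv.addRight c).summable_iff.2 (hasSum_norm_sq U).summable

/-- The three-shell local size of a state at shell `n`. [folklore] -/
def locNorm (U : lp (fun _ : ℤ => EuclideanSpace ℝ (Fin m)) 2) (n : ℤ) : ℝ :=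
  ‖U (n + -1)‖ + ‖U (n + 0)‖ + ‖U (n + 1)‖

/-- `locNorm ≥ 0`. [folklore] -/
theorem locNorm_nonneg (U : lp (fun _ : ℤ => EuclideanSpace ℝ (Fin m)) 2) (n : ℤ) : 0 ≤ locNorm U n := by
  unfold locNorm; positivity
/-- `locNorm² ≤ 3 (‖U_{n−1}‖² + ‖U_n‖² + ‖U_{n+1}‖²)`. [folklore] -/
theorem locNorm_sq_le (U : lp (fun _ : ℤ => EuclideanSpace ℝ (Fin m)) 2) (n : ℤ) :
    locNorm U n ^ 2 ≤ 3 * (‖U (n + -1)‖ ^ 2 + ‖U (n + 0)‖ ^ 2 + ‖U (n + 1)‖ ^ 2) := by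
  unfold locNorm
  nlinarith [sq_nonneg (‖U (n + -1)‖ - ‖U (n + 0)‖), sq_nonneg (‖U (n + 0)‖ - ‖U (n + 1)‖),
    sq_nonneg (‖U (n + -1)‖ - ‖U (n + 1)‖)]

/-- The windowed family of a state is bounded by the local size. [folklore] -/
theorem abs_windowFam_l2Fam_le (U : lp (fun _ : ℤ => EuclideanSpace ℝ (Fin m)) 2) (n : ℤ) (j : Fin m)
    (k : ℤ) (t : ℝ) : |windowFam n (l2Fam U) j k t| ≤ locNorm U n := by
  unfold windowFam
  split_ifs with hk
  · have hk' : k = n + -1 ∨ k = n + 0 ∨ k = n + 1 := by omega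
    have hb := abs_l2Fam_le_norm_apply U j k t
    unfold locNorm
    rcases hk' with rfl | rfl | rfl
    · linarith [norm_nonneg (U (n + 0)), norm_nonneg (U (n + 1))]
    · linarith [norm_nonneg (U (n + -1)), norm_nonneg (U (n + 1))]
    · linarith [norm_nonneg (U (n + -1)), norm_nonneg (U (n + 0))]
  · rw [abs_zero]; exact locNorm_nonneg U n

/-- Coordinates of differences. [folklore] -/
theorem l2Fam_sub (U V : lp (fun _ : ℤ => EuclideanSpace ℝ (Fin m)) 2) :
    l2Fam (U - V) = l2Fam U - l2Fam V := by
  funext j k t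
  simp [l2Fam]

/-- Coordinates of negatives. [folklore] -/
theorem l2Fam_neg (U : lp (fun _ : ℤ => EuclideanSpace ℝ (Fin m)) 2) : l2Fam (-U) = (-1 : ℝ) • l2Fam U := by
  funext j k t
  simp [l2Fam]

/-! ### The field on `ℓ²` -/

/-- **Pointwise local Lipschitz bound of the nonlinearity on `ℓ²`-balls**: for `‖U‖, ‖V‖ ≤ ρ`,
`|Q(U)_{i,n} − Q(V)_{i,n}| ≤ 2‖α‖₁ ρ · (‖(U−V)_{n−1}‖ + ‖(U−V)_n‖ + ‖(U−V)_{n+1}‖)` (midpoint polarisation and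
locality). [cite: Tao2016AveragedNS, §4 (4.8); folklore estimate] -/
theorem abs_quadTermOn_l2Fam_sub_le {𝕊 : Finset (ℤ × ℤ × ℤ)} (h𝕊 : IsNearestNeighbourSet 𝕊)
    (α : Fin m → Fin m → Fin m → ℤ × ℤ × ℤ → ℝ) {U V : lp (fun _ : ℤ => EuclideanSpace ℝ (Fin m)) 2}
    {ρ : ℝ} (hU : ‖U‖ ≤ ρ) (hV : ‖V‖ ≤ ρ) (i : Fin m) (n : ℤ) :
    |quadTermOn 𝕊 0 α (l2Fam U) i n 0 - quadTermOn 𝕊 0 α (l2Fam V) i n 0| ≤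
      2 * tableAbsSum 𝕊 α * ρ * locNorm (U - V) n := by
  rw [quadTermOn_sub_eq_linTermOn_mid, ← l2Fam_sub, ← linTermOn_windowFam h𝕊]
  refine abs_linTermOn_zero_le 𝕊 α (fun j k => ?_) (fun j k => abs_windowFam_l2Fam_le (U - V) n j k 0) i n
  simp only [Pi.smul_apply, Pi.add_apply, smul_eq_mul]
  have h1 := abs_l2Fam_le U j k 0
  have h2 := abs_l2Fam_le V j k 0
  rw [abs_mul, abs_of_pos (by norm_num : (0:ℝ) < 1 / 2)]
  linarith [abs_add_le (l2Fam U j k 0) (l2Fam V j k 0)]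

/-- The components of the field: shell `n` ↦ the vector `(Q(U)_{i,n})_i ∈ ℝ^m`. [cite: Tao2016AveragedNS, §4 (4.8)] -/
def l2FieldFun (𝕊 : Finset (ℤ × ℤ × ℤ)) (α : Fin m → Fin m → Fin m → ℤ × ℤ × ℤ → ℝ)
    (U : lp (fun _ : ℤ => EuclideanSpace ℝ (Fin m)) 2) : ℤ → EuclideanSpace ℝ (Fin m) :=
  fun n => WithLp.toLp 2 fun i => quadTermOn 𝕊 0 α (l2Fam U) i n 0

/-- Components of `l2FieldFun`. [cite: Tao2016AveragedNS, §4 (4.8)] -/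
theorem l2FieldFun_apply (𝕊 : Finset (ℤ × ℤ × ℤ)) (α : Fin m → Fin m → Fin m → ℤ × ℤ × ℤ → ℝ)
    (U : lp (fun _ : ℤ => EuclideanSpace ℝ (Fin m)) 2) (n : ℤ) (i : Fin m) :
    l2FieldFun 𝕊 α U n i = quadTermOn 𝕊 0 α (l2Fam U) i n 0 := rfl

/-- The field vanishes at the vacuum. [cite: Tao2016AveragedNS, §4 (4.8)] -/
theorem l2FieldFun_zero (𝕊 : Finset (ℤ × ℤ × ℤ)) (α : Fin m → Fin m → Fin m → ℤ × ℤ × ℤ → ℝ) (n : ℤ) :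
    l2FieldFun 𝕊 α (0 : lp (fun _ : ℤ => EuclideanSpace ℝ (Fin m)) 2) n = 0 := by
  have h0 : l2Fam (0 : lp (fun _ : ℤ => EuclideanSpace ℝ (Fin m)) 2) = (0 : ℝ) • l2Fam (0 : lp _ 2) := by
    funext j k t; simp [l2Fam]
  ext i
  rw [l2FieldFun_apply, h0, quadTermOn_smul]
  simp

/-- **Shell-wise Lipschitz bound**: `‖Q(U)_n − Q(V)_n‖² ≤ m (2‖α‖₁ρ)² locNorm(U−V)_n²` on the ball `‖U‖, ‖V‖ ≤ ρ`.
[cite: Tao2016AveragedNS, §4 (4.8); folklore estimate] -/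
theorem norm_l2FieldFun_sub_sq_le {𝕊 : Finset (ℤ × ℤ × ℤ)} (h𝕊 : IsNearestNeighbourSet 𝕊)
    (α : Fin m → Fin m → Fin m → ℤ × ℤ × ℤ → ℝ) {U V : lp (fun _ : ℤ => EuclideanSpace ℝ (Fin m)) 2}
    {ρ : ℝ} (hU : ‖U‖ ≤ ρ) (hV : ‖V‖ ≤ ρ) (n : ℤ) :
    ‖l2FieldFun 𝕊 α U n - l2FieldFun 𝕊 α V n‖ ^ 2 ≤
      m * (2 * tableAbsSum 𝕊 α * ρ * locNorm (U - V) n) ^ 2 := by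
  refine norm_sq_le_of_abs_le _ fun j => ?_
  have e : (l2FieldFun 𝕊 α U n - l2FieldFun 𝕊 α V n) j =
      quadTermOn 𝕊 0 α (l2Fam U) j n 0 - quadTermOn 𝕊 0 α (l2Fam V) j n 0 := by
    simp [l2FieldFun]
  rw [e]
  exact abs_quadTermOn_l2Fam_sub_le h𝕊 α hU hV j n

/-- The field maps `ℓ²` to `ℓ²`. [cite: Tao2016AveragedNS, §4 (4.8); folklore] -/
theorem memℓp_l2FieldFun {𝕊 : Finset (ℤ × ℤ × ℤ)} (h𝕊 : IsNearestNeighbourSet 𝕊)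
    (α : Fin m → Fin m → Fin m → ℤ × ℤ × ℤ → ℝ) (U : lp (fun _ : ℤ => EuclideanSpace ℝ (Fin m)) 2) :
    Memℓp (l2FieldFun 𝕊 α U) 2 := by
  rw [memℓp_gen_iff (by norm_num : 0 < (2 : ℝ≥0∞).toReal)]
  simp only [ENNReal.toReal_ofNat, Real.rpow_two]
  set C : ℝ := m * (2 * tableAbsSum 𝕊 α * ‖U‖) ^ 2 * 3 with hC
  have hg : Summable fun n : ℤ => C * (‖U (n + -1)‖ ^ 2 + ‖U (n + 0)‖ ^ 2 + ‖U (n + 1)‖ ^ 2) :=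
    (((summable_norm_sq_shift U (-1)).add (summable_norm_sq_shift U 0)).add
      (summable_norm_sq_shift U 1)).mul_left C
  refine Summable.of_nonneg_of_le (fun n => sq_nonneg _) (fun n => ?_) hg
  have h := norm_l2FieldFun_sub_sq_le h𝕊 α (U := U) (V := 0) le_rfl (by simp) n
  rw [l2FieldFun_zero, sub_zero, sub_zero] at h
  have hl := locNorm_sq_le U n
  have hK : 0 ≤ m * (2 * tableAbsSum 𝕊 α * ‖U‖) ^ 2 := by positivity
  calc ‖l2FieldFun 𝕊 α U n‖ ^ 2 ≤ m * (2 * tableAbsSum 𝕊 α * ‖U‖ * locNorm U n) ^ 2 := h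
    _ = m * (2 * tableAbsSum 𝕊 α * ‖U‖) ^ 2 * locNorm U n ^ 2 := by ring
    _ ≤ m * (2 * tableAbsSum 𝕊 α * ‖U‖) ^ 2 *
          (3 * (‖U (n + -1)‖ ^ 2 + ‖U (n + 0)‖ ^ 2 + ‖U (n + 1)‖ ^ 2)) :=
        mul_le_mul_of_nonneg_left hl hK
    _ = C * (‖U (n + -1)‖ ^ 2 + ‖U (n + 0)‖ ^ 2 + ‖U (n + 1)‖ ^ 2) := by rw [hC]; ring

/-- **The homogeneous `𝕊`-lattice field on `ℓ²(ℤ; ℝ^m)`**, `U ↦ Q(U)`. [cite: Tao2016AveragedNS, §4 (4.8)] -/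
def l2Field {𝕊 : Finset (ℤ × ℤ × ℤ)} (h𝕊 : IsNearestNeighbourSet 𝕊)
    (α : Fin m → Fin m → Fin m → ℤ × ℤ × ℤ → ℝ) (U : lp (fun _ : ℤ => EuclideanSpace ℝ (Fin m)) 2) :
    lp (fun _ : ℤ => EuclideanSpace ℝ (Fin m)) 2 :=
  ⟨l2FieldFun 𝕊 α U, memℓp_l2FieldFun h𝕊 α U⟩

/-- Components of `l2Field`. [cite: Tao2016AveragedNS, §4 (4.8)] -/
theorem l2Field_apply {𝕊 : Finset (ℤ × ℤ × ℤ)} (h𝕊 : IsNearestNeighbourSet 𝕊)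
    (α : Fin m → Fin m → Fin m → ℤ × ℤ × ℤ → ℝ) (U : lp (fun _ : ℤ => EuclideanSpace ℝ (Fin m)) 2)
    (n : ℤ) (i : Fin m) : (l2Field h𝕊 α U : ∀ _ : ℤ, EuclideanSpace ℝ (Fin m)) n i =
      quadTermOn 𝕊 0 α (l2Fam U) i n 0 := rfl

/-- Shells of `l2Field`. [cite: Tao2016AveragedNS, §4 (4.8)] -/
theorem l2Field_coe {𝕊 : Finset (ℤ × ℤ × ℤ)} (h𝕊 : IsNearestNeighbourSet 𝕊)
    (α : Fin m → Fin m → Fin m → ℤ × ℤ × ℤ → ℝ) (U : lp (fun _ : ℤ => EuclideanSpace ℝ (Fin m)) 2)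
    (n : ℤ) : (l2Field h𝕊 α U : ∀ _ : ℤ, EuclideanSpace ℝ (Fin m)) n = l2FieldFun 𝕊 α U n := rfl

/-- **Lipschitz bound on balls**: `‖Q(U) − Q(V)‖ ≤ 6 √m ‖α‖₁ ρ ‖U − V‖` for `‖U‖, ‖V‖ ≤ ρ`.
[cite: Tao2016AveragedNS, §4 (4.8); folklore estimate] -/
theorem norm_l2Field_sub_le {𝕊 : Finset (ℤ × ℤ × ℤ)} (h𝕊 : IsNearestNeighbourSet 𝕊)
    (α : Fin m → Fin m → Fin m → ℤ × ℤ × ℤ → ℝ) {U V : lp (fun _ : ℤ => EuclideanSpace ℝ (Fin m)) 2}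
    {ρ : ℝ} (hρ : 0 ≤ ρ) (hU : ‖U‖ ≤ ρ) (hV : ‖V‖ ≤ ρ) :
    ‖l2Field h𝕊 α U - l2Field h𝕊 α V‖ ≤ 6 * Real.sqrt m * tableAbsSum 𝕊 α * ρ * ‖U - V‖ := by
  have hA := tableAbsSum_nonneg 𝕊 α
  have hC : 0 ≤ 6 * Real.sqrt m * tableAbsSum 𝕊 α * ρ * ‖U - V‖ := by positivity
  refine lp.norm_le_of_forall_sum_le (by norm_num : 0 < (2 : ℝ≥0∞).toReal) hC fun s => ?_
  simp only [ENNReal.toReal_ofNat, Real.rpow_two, lp.coeFn_sub, Pi.sub_apply, l2Field_coe]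
  have hK : 0 ≤ m * (2 * tableAbsSum 𝕊 α * ρ) ^ 2 := by positivity
  have hterm : ∀ n ∈ s, ‖l2FieldFun 𝕊 α U n - l2FieldFun 𝕊 α V n‖ ^ 2 ≤
      m * (2 * tableAbsSum 𝕊 α * ρ) ^ 2 * 3 *
        (‖(U - V) (n + -1)‖ ^ 2 + ‖(U - V) (n + 0)‖ ^ 2 + ‖(U - V) (n + 1)‖ ^ 2) := by
    intro n _
    have h := norm_l2FieldFun_sub_sq_le h𝕊 α hU hV n
    have hl := locNorm_sq_le (U - V) n
    calc ‖l2FieldFun 𝕊 α U n - l2FieldFun 𝕊 α V n‖ ^ 2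
        ≤ m * (2 * tableAbsSum 𝕊 α * ρ * locNorm (U - V) n) ^ 2 := h
      _ = m * (2 * tableAbsSum 𝕊 α * ρ) ^ 2 * locNorm (U - V) n ^ 2 := by ring
      _ ≤ m * (2 * tableAbsSum 𝕊 α * ρ) ^ 2 *
            (3 * (‖(U - V) (n + -1)‖ ^ 2 + ‖(U - V) (n + 0)‖ ^ 2 + ‖(U - V) (n + 1)‖ ^ 2)) :=
          mul_le_mul_of_nonneg_left hl hK
      _ = _ := by ring
  have hs := sum_norm_sq_shift_le (U - V) s
  calc ∑ n ∈ s, ‖l2FieldFun 𝕊 α U n - l2FieldFun 𝕊 α V n‖ ^ 2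
      ≤ ∑ n ∈ s, m * (2 * tableAbsSum 𝕊 α * ρ) ^ 2 * 3 *
          (‖(U - V) (n + -1)‖ ^ 2 + ‖(U - V) (n + 0)‖ ^ 2 + ‖(U - V) (n + 1)‖ ^ 2) :=
        Finset.sum_le_sum hterm
    _ = m * (2 * tableAbsSum 𝕊 α * ρ) ^ 2 * 3 *
          (∑ n ∈ s, ‖(U - V) (n + -1)‖ ^ 2 + ∑ n ∈ s, ‖(U - V) (n + 0)‖ ^ 2 +
            ∑ n ∈ s, ‖(U - V) (n + 1)‖ ^ 2) := by
        rw [← Finset.mul_sum, Finset.sum_add_distrib, Finset.sum_add_distrib]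
    _ ≤ m * (2 * tableAbsSum 𝕊 α * ρ) ^ 2 * 3 * (‖U - V‖ ^ 2 + ‖U - V‖ ^ 2 + ‖U - V‖ ^ 2) := by
        gcongr
        · exact hs (-1)
        · exact hs 0
        · exact hs 1
    _ = (6 * Real.sqrt m * tableAbsSum 𝕊 α * ρ * ‖U - V‖) ^ 2 := by
        have hm : Real.sqrt (m : ℝ) ^ 2 = m := Real.sq_sqrt (Nat.cast_nonneg m)
        rw [show (6 * Real.sqrt m * tableAbsSum 𝕊 α * ρ * ‖U - V‖) ^ 2 =
          36 * Real.sqrt (m : ℝ) ^ 2 * tableAbsSum 𝕊 α ^ 2 * ρ ^ 2 * ‖U - V‖ ^ 2 by ring, hm]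
        ring

/-- **The field is Lipschitz on every ball** `‖U‖ ≤ ρ` (`ρ ≥ 0`), constant `6 √m ‖α‖₁ ρ`.
[cite: Tao2016AveragedNS, §4 (4.8); folklore estimate] -/
theorem lipschitzOnWith_l2Field {𝕊 : Finset (ℤ × ℤ × ℤ)} (h𝕊 : IsNearestNeighbourSet 𝕊)
    (α : Fin m → Fin m → Fin m → ℤ × ℤ × ℤ → ℝ) {ρ : ℝ} (hρ : 0 ≤ ρ) :
    LipschitzOnWith (Real.toNNReal (6 * Real.sqrt m * tableAbsSum 𝕊 α * ρ)) (l2Field h𝕊 α)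
      (closedBall 0 ρ) := by
  refine LipschitzOnWith.of_dist_le_mul fun U hU V hV => ?_
  rw [mem_closedBall, dist_zero_right] at hU hV
  have hK : 0 ≤ 6 * Real.sqrt m * tableAbsSum 𝕊 α * ρ := by
    have := tableAbsSum_nonneg 𝕊 α; positivity
  rw [Real.coe_toNNReal _ hK, dist_eq_norm, dist_eq_norm]
  exact norm_l2Field_sub_le h𝕊 α hρ hU hV

/-- **Time-reversal symmetry of the quadratic field**: `Q(−U) = Q(U)`. [cite: Tao2016AveragedNS, §4 (4.8)] -/
theorem l2Field_neg {𝕊 : Finset (ℤ × ℤ × ℤ)} (h𝕊 : IsNearestNeighbourSet 𝕊)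
    (α : Fin m → Fin m → Fin m → ℤ × ℤ × ℤ → ℝ) (U : lp (fun _ : ℤ => EuclideanSpace ℝ (Fin m)) 2) :
    l2Field h𝕊 α (-U) = l2Field h𝕊 α U := by
  refine lp.ext (funext fun n => ?_)
  ext i
  rw [l2Field_apply, l2Field_apply, l2Fam_neg, quadTermOn_smul]
  norm_num

/-! ### Energy neutrality -/

/-- The same-shell cubic sum `A_𝕊(n)` of a finite-energy state is summable over the shells (it is cubic,
with every factor on the shells `n, n+1`). [cite: Tao2016AveragedNS, §4 proof of Lemma 4.1 (v); folklore] -/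
theorem summable_topSumOn_l2Fam {𝕊 : Finset (ℤ × ℤ × ℤ)} (h𝕊 : IsNearestNeighbourSet 𝕊)
    (α : Fin m → Fin m → Fin m → ℤ × ℤ × ℤ → ℝ) (U : lp (fun _ : ℤ => EuclideanSpace ℝ (Fin m)) 2) :
    Summable fun n : ℤ => topSumOn 𝕊 0 α (l2Fam U) n 0 := by
  set C : ℝ := coeffAbsOn (topShifts 𝕊) α with hC
  have hC0 : 0 ≤ C := coeffAbsOn_nonneg _ _
  have hg : Summable fun n : ℤ => 4 * ‖U‖ * C * (‖U (n + 0)‖ ^ 2 + ‖U (n + 1)‖ ^ 2) :=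
    ((summable_norm_sq_shift U 0).add (summable_norm_sq_shift U 1)).mul_left _
  refine Summable.of_norm_bounded hg fun n => ?_
  rw [Real.norm_eq_abs]
  set M : ℝ := ‖U (n + 0)‖ + ‖U (n + 1)‖ with hM
  have hM0 : 0 ≤ M := by positivity
  have hX : ∀ i, |l2Fam U i n 0| ≤ M ∧ |l2Fam U i (n + 1) 0| ≤ M := fun i =>
    ⟨(abs_l2Fam_le_norm_apply U i n 0).trans (by rw [hM, add_zero]; linarith [norm_nonneg (U (n + 1))]),
      (abs_l2Fam_le_norm_apply U i (n + 1) 0).trans (by rw [hM]; linarith [norm_nonneg (U (n + 0))])⟩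
  have h := abs_topSumOn_le_of_abs_le h𝕊 0 (by norm_num) α (l2Fam U) n 0 hM0 hX
  simp only [add_zero, Real.one_rpow, one_mul] at h
  have hMle : M ≤ 2 * ‖U‖ := by
    have h1 := lp.norm_apply_le_norm (by norm_num : (2 : ℝ≥0∞) ≠ 0) U (n + 0)
    have h2 := lp.norm_apply_le_norm (by norm_num : (2 : ℝ≥0∞) ≠ 0) U (n + 1)
    rw [hM]; linarith
  have hM2 : M ^ 2 ≤ 2 * (‖U (n + 0)‖ ^ 2 + ‖U (n + 1)‖ ^ 2) := by
    rw [hM]; nlinarith [sq_nonneg (‖U (n + 0)‖ - ‖U (n + 1)‖)]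
  calc |topSumOn 𝕊 0 α (l2Fam U) n 0| ≤ M ^ 3 * C := h
    _ = M * M ^ 2 * C := by ring
    _ ≤ (2 * ‖U‖) * (2 * (‖U (n + 0)‖ ^ 2 + ‖U (n + 1)‖ ^ 2)) * C := by gcongr
    _ = 4 * ‖U‖ * C * (‖U (n + 0)‖ ^ 2 + ‖U (n + 1)‖ ^ 2) := by ring

/-- The shell-`n` inner product of the field with the state is the energy bookkeeping
`∑ᵢ Q(U)_{i,n} U_{i,n} = A_𝕊(n) − A_𝕊(n−1)` (slot-closed `𝕊`, cancelling table).
[cite: Tao2016AveragedNS, §4 (4.3) and proof of Lemma 4.1 (v)] -/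
theorem inner_l2Field_apply {𝕊 : Finset (ℤ × ℤ × ℤ)} (h𝕊 : IsNearestNeighbourSet 𝕊) (h𝕊' : IsSlotClosed 𝕊)
    {α : Fin m → Fin m → Fin m → ℤ × ℤ × ℤ → ℝ} (hα : IsCancellingCoeffOn 𝕊 α)
    (U : lp (fun _ : ℤ => EuclideanSpace ℝ (Fin m)) 2) (n : ℤ) :
    ⟪(l2Field h𝕊 α U : ∀ _ : ℤ, EuclideanSpace ℝ (Fin m)) n, U n⟫ =
      topSumOn 𝕊 0 α (l2Fam U) n 0 - topSumOn 𝕊 0 α (l2Fam U) (n - 1) 0 := by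
  have e : ⟪(l2Field h𝕊 α U : ∀ _ : ℤ, EuclideanSpace ℝ (Fin m)) n, U n⟫ =
      ∑ i, quadTermOn 𝕊 0 α (l2Fam U) i n 0 * l2Fam U i n 0 := by
    rw [PiLp.inner_apply]
    refine Finset.sum_congr rfl fun i _ => ?_
    simp [l2Field_coe, l2FieldFun, l2Fam, mul_comm]
  rw [e, sum_quadTermOn_mul h𝕊.out_eq_zero_or_one, botSumOn_eq_neg_topSumOn h𝕊' h𝕊.out_eq_zero_or_one 0 hα]
  ring

/-- **ENERGY NEUTRALITY of the homogeneous lattice field on `ℓ²`**: for a nearest-neighbour, slot-closed shift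
set and a table cancelling on it (Tao's (4.3)), `⟪Q(U), U⟫ = 0` for every finite-energy state `U` — the
shell-wise bookkeeping `∑ᵢ Q(U)_{i,n}U_{i,n} = A_𝕊(n) − A_𝕊(n−1)` telescopes over `ℤ` because `A_𝕊` is summable.
[cite: Tao2016AveragedNS, §4 (4.3) and proof of Lemma 4.1 (v) ("all the terms here can be grouped into terms that sum to zero")] -/
theorem inner_l2Field_self {𝕊 : Finset (ℤ × ℤ × ℤ)} (h𝕊 : IsNearestNeighbourSet 𝕊) (h𝕊' : IsSlotClosed 𝕊)
    {α : Fin m → Fin m → Fin m → ℤ × ℤ × ℤ → ℝ} (hα : IsCancellingCoeffOn 𝕊 α)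
    (U : lp (fun _ : ℤ => EuclideanSpace ℝ (Fin m)) 2) : ⟪l2Field h𝕊 α U, U⟫ = 0 := by
  have hs := summable_topSumOn_l2Fam h𝕊 α U
  have hs' : Summable fun n : ℤ => topSumOn 𝕊 0 α (l2Fam U) (n - 1) 0 := by
    simpa [Function.comp_def] using (Equiv.subRight (1 : ℤ)).summable_iff.2 hs
  have e : ∑' n : ℤ, topSumOn 𝕊 0 α (l2Fam U) (n - 1) 0 = ∑' n : ℤ, topSumOn 𝕊 0 α (l2Fam U) n 0 := by
    simpa using (Equiv.subRight (1 : ℤ)).tsum_eq fun n => topSumOn 𝕊 0 α (l2Fam U) n 0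
  have h1 : ⟪l2Field h𝕊 α U, U⟫ = ∑' n : ℤ, ⟪(l2Field h𝕊 α U : ∀ _ : ℤ, EuclideanSpace ℝ (Fin m)) n, U n⟫ :=
    lp.inner_eq_tsum _ _
  have h2 : (fun n : ℤ => ⟪(l2Field h𝕊 α U : ∀ _ : ℤ, EuclideanSpace ℝ (Fin m)) n, U n⟫) =
      fun n : ℤ => topSumOn 𝕊 0 α (l2Fam U) n 0 - topSumOn 𝕊 0 α (l2Fam U) (n - 1) 0 :=
    funext fun n => inner_l2Field_apply h𝕊 h𝕊' hα U n
  rw [h1, h2, hs.tsum_sub hs', e, sub_self]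

end QuadPolar

end Summit.NavierStokesRegularity.NavierStokesRegularity.Theorems

end
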